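import Literature.Computability.Complexity.CodeFP
import Literature.Computability.Complexity.ZIntBricks
import Literature.Computability.Complexity.NatSqrtFP
import Literature.Computability.Complexity.IntVectorBricks
import HarnessLib

/-!
# Typed polynomial time on codes, II: strings, unary budgets, division, roots, powers, integers

Trunk `CplxCore`, sequel of `CodeFP.lean` (the predicate `CodeFP eα eβ g`: the map `g : α → β` is
computed on codes by an `FP` string function, with its structural, numeral and list combinators).
A numerical machine written as a functional program — the reduction machine of the discharge of
Aaronson–Arkhipov's Thm. 1.3 (a coin-driven sampler reading blocks of a coin string, an integral
Gram–Schmidt table, integer square roots, a final quotient) — needs a few more typed leaves, all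
of which exist in the tree as bricks; this file only TYPES them:

* **strings as their own codes** (`strE = id`): `strTake`/`strDrop` (by a unary count,
  `Plumb.takeFn`/`dropFn`), `strLength` (`onesFn`), `strVal` (the value `bitsToNat` of a block as a
  canonical binary numeral, `addFn ⟨w, ε⟩`), `strAppend`;
* **unary budgets**: `replicateUnit` (`1ⁿ ↦` the raw list of `n` unit items, `Brick.zerosFn`), whence
  `urange` (`1ⁿ ↦ [0, …, n-1]` in binary, through `brange`) and **`natPow`** (`(s, 1ᵏ) ↦ sᵏ`, a fold
  over the budget; binary exponents are not polynomial);
* numerals: `natDiv`, `natMod` (`divFn`, `remFn`), **`natSqrt`** (`Brick.natSqrt_mem_FP`), `natMin`;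
* **integers** in the canonical difference-pair code `intE = Brick.dpEnc` of `IntPairBricks.lean` /
  `ZIntBricks.lean`: `intAdd`, `intSub`, `intMul`, `intNeg`, `intLe`, `intLt`, `intEDiv` (Lean's `Int.ediv`
  conventions, `zedivF_dpEnc`), `intAbs`, `intOfNat`, `intToNat`, `intNatAbs`, and the bridges
  `intOfSM`/`smOfInt` with the sign–magnitude code `smE = encodingIntBool.encode` in which the tree's
  problem instances (`encodeGPEQuery`, `encodingBosonInput`) carry their integer entries;
* lists: `rawTakeUn`/`rawDropUn` (by a unary count), `rawHeadOr`/`rawGetOr` (head / item at a binary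
  index with a default from the context, for item codes whose default is not `ε`), `rawEnum`
  (`l ↦ zip [0, …) l`), and **`strChunks`** (`(1ᴺ, 1ᵏ, w) ↦` the `N` consecutive length-`k` blocks of
  `w`: how a machine reads the fields of its coin string).

Everything is proved; no machine, transducer or growth estimate is written beyond the accumulator
bounds of the two folds (`natPow`: `|bin sⁱ| ≤ i |bin s| + 1`; `rawDropUn`: tails shrink).

## References

* S. Arora, B. Barak, *Computational Complexity: A Modern Approach*, CUP 2009, §1.2–1.3
  (polynomial-time computable functions; closure under composition and polynomially bounded
  loops), §0.1 (codes of tuples and lists).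
* D. E. Knuth, *The Art of Computer Programming*, Vol. 2, 3rd ed., Addison-Wesley 1998, §4.3.1
  (multiple-precision arithmetic), §4.6.3 (powers by repeated multiplication). (Schoolbook; the
  bricks are proved in the tree.)
-/

namespace Literature.Computability.Complexity

open _root_.Computability Polynomial Brick

namespace CodeFP

variable {α β γ σ : Type} {eα : α → List Bool} {eβ : β → List Bool} {eγ : γ → List Bool}
  {eσ : σ → List Bool}

/-! ### Strings as their own codes -/

/-- Bit strings coded by themselves. [folklore] -/
abbrev strE : List Bool → List Bool := id

/-- `(1ⁿ, w) ↦ w ↾ n`. [folklore] -/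
theorem strTake : CodeFP (pairE unE strE) strE (fun p => p.2.take p.1) :=
  ⟨Plumb.takeFn, Plumb.takeFn_mem_FP, fun p => by
    rw [pairE_apply, Plumb.takeFn_boolPair, length_unE]; rfl⟩

/-- `(1ⁿ, w) ↦ w ⇂ n`. [folklore] -/
theorem strDrop : CodeFP (pairE unE strE) strE (fun p => p.2.drop p.1) :=
  ⟨Plumb.dropFn, Plumb.dropFn_mem_FP, fun p => by
    rw [pairE_apply, Plumb.dropFn_boolPair, length_unE]; rfl⟩

/-- The length of a string, in unary. [folklore] -/
theorem strLength : CodeFP strE unE List.length := ⟨onesFn, onesFn_mem_FP, fun _ => rfl⟩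

/-- **The value of a block of bits** (least significant bit first, the total `bitsToNat`) as a
canonical binary numeral. [folklore] -/
theorem strVal : CodeFP strE natE bitsToNat :=
  ⟨addFn ∘ fanoutFn id (fun _ => []),
    comp_mem_FP addFn_mem_FP (fanoutFn_mem_FP (PolyTimeComputable.id _) (const_mem_FP _)), fun w => by
    simp⟩

/-- Concatenation of strings. [folklore] -/
theorem strAppend : CodeFP (pairE strE strE) strE (fun p => p.1 ++ p.2) :=
  ⟨fun z => fstF z ++ sndF z, append_mem_FP fstF_mem_FP sndF_mem_FP, fun p => by simp⟩

/-- A binary numeral read as a string. [folklore] -/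
theorem strOfNat : CodeFP natE strE (fun n => natE n) := recode fun _ => rfl

/-- A unary numeral read as a string. [folklore] -/
theorem strOfUn : CodeFP unE strE (fun n => unE n) := recode fun _ => rfl

/-! ### Unit lists as unary budgets; ranges; powers -/

/-- Unit items are coded by `ε`. [folklore] -/
def unitE : Unit → List Bool := fun _ => []

/-- The iterated-pair list code `OracleCompose.body` is `encList`. [folklore] -/
theorem body_eq_encList (L : List (List Bool)) : OracleCompose.body L = encList L := by
  induction L with
  | nil => rfl
  | cons a L ih => rw [OracleCompose.body_cons, encList_cons, ih]

/-- **`1ⁿ ↦` the raw list of `n` unit items** (the string `(01)ⁿ`, `Brick.zerosFn`): the budget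
list over which a loop of `n` rounds is a fold. [folklore] -/
theorem replicateUnit : CodeFP unE (rawE unitE) (fun n => List.replicate n ()) :=
  ⟨zerosFn, zerosFn_mem_FP, fun n => by
    rw [zerosFn_apply, length_unE, body_eq_encList, rawE, List.map_replicate]; rfl⟩

/-- **`1ⁿ ↦ [0, …, n - 1]`** (binary items). [cite: AroraBarak2009, §1.3 (bounded loops)] -/
theorem urange : CodeFP unE (rawE natE) List.range :=
  ((brange unitE).comp (replicateUnit.pair natOfUn)).congr fun n => by
    simp

/-- Folding a constant multiplication over a list of units is a power. [folklore] -/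
theorem foldl_mul_const_units (s a : ℕ) (l : List Unit) :
    l.foldl (fun b _ => b * s) a = a * s ^ l.length := by
  induction l generalizing a with
  | nil => simp
  | cons u l ih => rw [List.foldl_cons, ih, List.length_cons]; ring

/-- `|bin (a · b)| ≤ |bin a| + |bin b|`. [folklore] -/
theorem length_natE_mul_le (a b : ℕ) : (natE (a * b)).length ≤ (natE a).length + (natE b).length :=
  length_encodeNat_mul_le a b

/-- `|bin (sᵏ)| ≤ k |bin s| + 1`. [folklore] -/
theorem length_natE_pow_le (s k : ℕ) : (natE (s ^ k)).length ≤ k * (natE s).length + 1 := by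
  induction k with
  | zero =>
    have : (natE 1).length = 1 := by
      rw [show natE 1 = encodeNat 1 from rfl, TM2Pass.length_encodeNat_eq_size]; rfl
    simp [this]
  | succ k ih =>
    rw [pow_succ]
    have h := length_natE_mul_le (s ^ k) s
    nlinarith [h, ih]

/-- **Powers with a unary exponent**: `(s, 1ᵏ) ↦ sᵏ` (repeated multiplication over the budget;
a binary exponent would not be polynomial). [cite: AroraBarak2009, §1.3 (bounded loops)] -/
theorem natPow : CodeFP (pairE natE unE) natE (fun p => p.1 ^ p.2) := by
  have hstep : CodeFP (pairE natE (pairE unitE natE)) natE (fun t => t.2.2 * t.1) :=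
    natMul.comp ((snd _ _).snd'.pair (fst _ _))
  have h := foldl (σ := ℕ) (α := Unit) (β := ℕ) (eσ := natE) (eα := unitE) (eβ := natE)
    (step := fun s _ b => b * s) (init := fun _ => 1) hstep (const natE 1) (X * X + 1)
    (fun s l₁ l₂ => by
      rw [foldl_mul_const_units, one_mul]
      refine (length_natE_pow_le s _).trans ?_
      rw [eval_add, eval_mul, eval_X, eval_one, pairE_apply, length_boolPair]
      have h1 : l₁.length ≤ (rawE unitE (l₁ ++ l₂)).length :=
        le_trans (by simp) (length_le_length_rawE unitE (l₁ ++ l₂))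
      nlinarith [h1])
  refine ((h.comp ((fst natE unE).pair (replicateUnit.comp (snd natE unE)))).congr fun p => ?_)
  simp [foldl_mul_const_units]

/-! ### More numerals -/

/-- Division of binary numerals (`n / 0 = 0`). [folklore] -/
theorem natDiv : CodeFP (pairE natE natE) natE (fun p => p.1 / p.2) :=
  ⟨divFn, divFn_mem_FP, fun p => by simp⟩

/-- Remainder of binary numerals. [folklore] -/
theorem natMod : CodeFP (pairE natE natE) natE (fun p => p.1 % p.2) :=
  ⟨remFn, remFn_mem_FP, fun p => by simp⟩

/-- **Integer square root of a binary numeral** (`Brick.natSqrt_mem_FP`). [cite: AroraBarak2009, §1.3] -/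
theorem natSqrt : CodeFP natE natE Nat.sqrt :=
  ⟨fun w => encodeNat (Nat.sqrt (bitsToNat w)), natSqrt_mem_FP, fun n => by simp⟩

/-- Minimum of binary numerals. [folklore] -/
theorem natMin : CodeFP (pairE natE natE) natE (fun p => min p.1 p.2) :=
  (natLe.ite (fst natE natE) (snd natE natE)).congr fun p => by
    by_cases h : p.1 ≤ p.2
    · simp [h]
    · simp [h, min_eq_right (Nat.le_of_not_le h)]

/-- Maximum of binary numerals. [folklore] -/
theorem natMax : CodeFP (pairE natE natE) natE (fun p => max p.1 p.2) :=
  (natLe.ite (snd natE natE) (fst natE natE)).congr fun p => by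
    by_cases h : p.1 ≤ p.2
    · simp [h]
    · simp [h, max_eq_left (Nat.le_of_not_le h)]

/-! ### Integers -/

/-- Integers in the canonical difference-pair code `⟨bin z⁺, bin z⁻⟩` of `IntPairBricks.lean`.
[folklore] -/
abbrev intE : ℤ → List Bool := dpEnc

/-- The integer code is injective. [folklore] -/
theorem intE_injective : Function.Injective intE := fun a b h => by
  simpa using congrArg ival h

/-- Addition of integers. [folklore] -/
theorem intAdd : CodeFP (pairE intE intE) intE (fun p => p.1 + p.2) :=
  ⟨zaddF, zaddF_mem_FP, fun p => by simp⟩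

/-- Subtraction of integers. [folklore] -/
theorem intSub : CodeFP (pairE intE intE) intE (fun p => p.1 - p.2) :=
  ⟨zsubF, zsubF_mem_FP, fun p => by simp⟩

/-- Multiplication of integers. [folklore] -/
theorem intMul : CodeFP (pairE intE intE) intE (fun p => p.1 * p.2) :=
  ⟨zmulF, zmulF_mem_FP, fun p => by simp⟩

/-- Negation of integers. [folklore] -/
theorem intNeg : CodeFP intE intE (fun z => -z) :=
  ⟨znegF, znegF_mem_FP, fun z => by simp⟩

/-- Comparison of integers. [folklore] -/
theorem intLe : CodeFP (pairE intE intE) bitE (fun p => decide (p.1 ≤ p.2)) :=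
  ⟨zleF, zleF_mem_FP, fun p => by simp [bitE]⟩

/-- Strict comparison of integers. [folklore] -/
theorem intLt : CodeFP (pairE intE intE) bitE (fun p => decide (p.1 < p.2)) :=
  (intLe.comp ((snd intE intE).pair (fst intE intE))).not.congr fun p => by
    by_cases h : p.1 < p.2
    · simp [h, not_le.2 h]
    · simp [h, not_lt.1 h]

/-- Equality of integers. [folklore] -/
theorem intEq : CodeFP (pairE intE intE) bitE (fun p => decide (p.1 = p.2)) := eq intE_injective

/-- **Integer division with Lean's conventions** (`Int.ediv`: floor for a positive divisor,
`x / (-d) = -(x / d)`, `x / 0 = 0`). [folklore] -/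
theorem intEDiv : CodeFP (pairE intE intE) intE (fun p => p.1 / p.2) :=
  ⟨zedivF, zedivF_mem_FP, fun p => zedivF_dpEnc p.1 p.2⟩

/-- Absolute value. [folklore] -/
theorem intAbs : CodeFP intE intE (fun z => |z|) :=
  ⟨zabsF, zabsF_mem_FP, fun z => zabsF_dpEnc z⟩

/-- Naturals as integers: `bin n ↦ ⟨bin n, ε⟩`. [folklore] -/
theorem intOfNat : CodeFP natE intE (fun n => (n : ℤ)) :=
  ⟨fanoutFn id (fun _ => []), fanoutFn_mem_FP (PolyTimeComputable.id _) (const_mem_FP _), fun n => by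
    simp [dpEnc]⟩

/-- The positive part `z⁺ = z.toNat` of an integer. [folklore] -/
theorem intToNat : CodeFP intE natE Int.toNat :=
  ⟨fstF, fstF_mem_FP, fun z => by simp [dpEnc]⟩

/-- The absolute value as a natural number. [folklore] -/
theorem intNatAbs : CodeFP intE natE Int.natAbs :=
  (intToNat.comp intAbs).congr fun z => by
    rw [Int.abs_eq_natAbs, Int.toNat_natCast]

/-- The sign–magnitude code `⟨[z < 0], bin |z|⟩` of `encodingIntBool` (the entry format of the
tree's problem instances). [folklore] -/
def smE : ℤ → List Bool := encodingIntBool.encode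

/-- Unfolding `smE`. [folklore] -/
theorem smE_apply (z : ℤ) : smE z = boolPair [decide (z < 0)] (encodeNat z.natAbs) := rfl

/-- `smE` is injective. [folklore] -/
theorem smE_injective : Function.Injective smE := encodingIntBool.encode_injective

/-- From sign–magnitude to difference pairs (`ofSMFn`). [folklore] -/
theorem intOfSM : CodeFP smE intE id := ⟨ofSMFn, ofSMFn_mem_FP, fun z => ofSMFn_encode z⟩

/-- From difference pairs to sign–magnitude (`signMagOfZF`). [folklore] -/
theorem smOfInt : CodeFP intE smE id := ⟨signMagOfZF, signMagOfZF_mem_FP, fun z => signMagOfZF_dpEnc z⟩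

/-! ### Typed lists: a few more combinators -/

/-- `take` by a unary count: `zipWith` against the budget. [folklore] -/
theorem rawTakeUn (eα : α → List Bool) :
    CodeFP (pairE unE (rawE eα)) (rawE eα) (fun p => p.2.take p.1) := by
  have hz := zipWith (σ := Unit) (eσ := unitE) (eα := eα) (eβ := unitE) (eγ := eα)
    (g := fun t => t.2.1) ((snd _ _).fst')
  refine ((hz.comp ((const _ ()).pair ((snd unE (rawE eα)).pair
    (replicateUnit.comp (fst unE (rawE eα)))))).congr fun p => ?_)
  obtain ⟨n, l⟩ := p
  simp only
  induction l generalizing n with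
  | nil => simp
  | cons a l ih =>
    cases n with
    | zero => simp
    | succ n => simp [List.replicate_succ, ih]

/-- Indexed items: `l ↦ zip [0, …) l` with binary indices (through the unary length of `l`). [folklore] -/
theorem rawEnum (eα : α → List Bool) :
    CodeFP (rawE eα) (rawE (pairE natE eα)) (fun l => (List.range l.length).zip l) := by
  have hz := zipWith (σ := Unit) (eσ := unitE) (eα := natE) (eβ := eα) (eγ := pairE natE eα)
    (g := fun t => (t.2.1, t.2.2)) ((snd _ _).fst'.pair (snd _ _).snd')
  refine ((hz.comp ((const _ ()).pair ((urange.comp (ulength eα)).pair (CodeFP.id _)))).congr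
    fun l => ?_)
  simp [List.zip]

/-- The length of a string, in binary. [folklore] -/
theorem strNatLength : CodeFP strE natE List.length := (natOfUn.comp strLength).congr fun _ => rfl

/-- Dropping items is a fold of `tail` over a budget. [folklore] -/
theorem foldl_tail_units (l : List α) (u : List Unit) :
    u.foldl (fun acc _ => acc.tail) l = l.drop u.length := by
  induction u generalizing l with
  | nil => simp
  | cons x u ih => rw [List.foldl_cons, ih, List.length_cons, List.drop_tail]

/-- `drop` by a unary count. [folklore] -/
theorem rawDropUn (eα : α → List Bool) :
    CodeFP (pairE unE (rawE eα)) (rawE eα) (fun p => p.2.drop p.1) := by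
  have hstep : CodeFP (pairE (rawE eα) (pairE unitE (rawE eα))) (rawE eα) (fun t => t.2.2.tail) :=
    (rawTail eα).comp (snd _ _).snd'
  have h := foldl (σ := List α) (α := Unit) (β := List α) (eσ := rawE eα) (eα := unitE)
    (eβ := rawE eα) (step := fun _ _ acc => acc.tail) (init := fun l => l) hstep (CodeFP.id _) X
    (fun l u₁ u₂ => by
      rw [foldl_tail_units, eval_X, pairE_apply, length_boolPair]
      have := length_rawE_le_of_sublist eα (List.drop_sublist u₁.length l)
      simp only
      omega)
  refine ((h.comp ((snd unE (rawE eα)).pair (replicateUnit.comp (fst unE (rawE eα))))).congr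
    fun p => ?_)
  simp [foldl_tail_units]

/-- Head with a default taken from the context. [folklore] -/
theorem rawHeadOr (eα : α → List Bool) :
    CodeFP (pairE eα (rawE eα)) eα (fun p => p.2.headD p.1) :=
  rawCases (k := fun (d : α) (l : List α) => l.headD d) (CodeFP.id eα) ((snd _ _).fst')
    (fun _ => rfl) (fun _ _ _ => rfl)

/-- **Indexing by a binary numeral with an arbitrary default**: `(l, i, d) ↦ l[i]` (or `d` past the
end), by dropping `min i |l|` items. [cite: AroraBarak2009, §1.3] -/
theorem rawGetOr (eα : α → List Bool) :
    CodeFP (pairE (rawE eα) (pairE natE eα)) eα (fun p => p.1.getD p.2.1 p.2.2) := by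
  have hl : CodeFP (pairE (rawE eα) (pairE natE eα)) (rawE eα) (fun t => t.1) := fst _ _
  have hi : CodeFP (pairE (rawE eα) (pairE natE eα)) natE (fun t => t.2.1) := (snd _ _).fst'
  have hd : CodeFP (pairE (rawE eα) (pairE natE eα)) eα (fun t => t.2.2) := (snd _ _).snd'
  have hn : CodeFP (pairE (rawE eα) (pairE natE eα)) unE (fun t => min t.2.1 t.1.length) :=
    unOfNatMin.comp (((ulength eα).comp hl).pair hi)
  refine (((rawHeadOr eα).comp (hd.pair ((rawDropUn eα).comp (hn.pair hl)))).congr fun t => ?_)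
  obtain ⟨l, i, d⟩ := t
  simp only
  by_cases h : i < l.length
  · rw [min_eq_left h.le, List.getD_eq_getElem _ _ h, ← List.getElem_cons_drop h]
    rfl
  · push Not at h
    rw [min_eq_right h, List.drop_length, List.getD_eq_default _ _ h]
    rfl

/-- **Cutting a string into consecutive blocks**: `(1ᴺ, 1ᵏ, w) ↦ [w[0,k), w[k,2k), …, w[(N-1)k, Nk)]`
(blocks past the end of `w` come out short or empty) — how a machine reads the fields of its
coin string. [cite: AroraBarak2009, §1.3] -/
theorem strChunks : CodeFP (pairE unE (pairE unE strE)) (rawE strE)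
    (fun p => (List.range p.1).map fun i => (p.2.2.drop (i * p.2.1)).take p.2.1) := by
  -- context `(1ᵏ, w)`, item `i` (binary)
  have hk : CodeFP (pairE (pairE unE strE) natE) unE (fun t => t.1.1) := (fst _ _).fst'
  have hw : CodeFP (pairE (pairE unE strE) natE) strE (fun t => t.1.2) := (fst _ _).snd'
  have hi : CodeFP (pairE (pairE unE strE) natE) natE (fun t => t.2) := snd _ _
  have hcnt : CodeFP (pairE (pairE unE strE) natE) unE (fun t => min (t.2 * t.1.1) t.1.2.length) :=
    unOfNatMin.comp ((strLength.comp hw).pair (natMul.comp (hi.pair (natOfUn.comp hk))))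
  have hg : CodeFP (pairE (pairE unE strE) natE) strE
      (fun t => (t.1.2.drop (t.2 * t.1.1)).take t.1.1) :=
    (strTake.comp (hk.pair (strDrop.comp (hcnt.pair hw)))).congr fun t => by
      simp only
      congr 1
      by_cases h : t.2 * t.1.1 ≤ t.1.2.length
      · rw [min_eq_left h]
      · push Not at h
        rw [min_eq_right h.le, List.drop_length, List.drop_eq_nil_of_le h.le]
  refine ((map hg).comp (((snd unE _).fst'.pair (snd unE _).snd').pair
    (urange.comp (fst unE _)))).congr fun p => ?_
  simp

end CodeFP

end Literature.Computability.Complexity
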